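import Summits.KontsevichZagierPeriods.KontsevichZagierPeriods.Theses.WZCosetWall
import Summits.KontsevichZagierPeriods.KontsevichZagierPeriods.Theses.AyoubSpecialisation
import Summits.KontsevichZagierPeriods.KontsevichZagierPeriods.Theorems.VietaFibreKernelFormItemDictionary
import Summits.KontsevichZagierPeriods.KontsevichZagierPeriods.Theorems.KernelFormKernelImpliesStatement
import Literature.NumberTheory.Transcendental.KZKernelConjectureForms
import Literature.NumberTheory.Transcendental.KZProduct
import Literature.Barriers.KontsevichZagierPeriods.PeriodEqualityDecidability

/-!
# `SeriesKernel` (stmt-KontsevichZagierPeriods-6872) — STRATEGY CENSUS, kernel-checked companion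

Crux-strategist unit `cstrat-stmt-KontsevichZagierPeriods-6872-s2` (gen 1, 2026-08-17), route
WZCosetWall. Companion of `Cruxes/SeriesKernel/STRATEGY-CENSUS.md`: every structural claim of the
census that can be typed is typed and proved here. Nothing in this file is a route item; no
statement is re-filed. Contents:

* §1 The language of the crux. `SigmaRule R` := the closure hypothesis of `SeriesKernel` with the
  subgroup `R` free (VERBATIM; `SummationClosure ↔ SigmaRule relations` and the unfolding of
  `SeriesKernel` are `Iff.rfl`); `sigmaClosure` := the least Σ-closed subgroup containing
  `relations` (an `sInf`); `SeriesKernel ↔ ker eval ≤ sigmaClosure`.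
* §2 The summit side. `KontsevichZagierPeriods → SeriesKernel`; the route's thesis is EXACTLY the
  summit: `KZKernelConjecture ↔ SummationClosure ∧ SeriesKernel` (uses §4: soundness of the rule).
* §3 DECOMPOSITION (the census's D1, the `[π]`-cut): `SeriesKernel_of_subs :
  AyoubPiLocalKernel → AyoubPiCancellation → SeriesKernel` (items 0541, 0540 by name, landed
  dictionary `kernelForm_iff_ayoubPiLocalKernel_and_ayoubPiCancellation`), and its exactness
  modulo the route's engine: `SummationClosure → (SeriesKernel ↔ 0541 ∧ 0540)`.
* §4 SOUNDNESS of the Σ-rule (claimed in the route header, proved here): dominated rational-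
  geometric families are summable at value level (`hasSum_value`), hence `ker eval` is Σ-closed
  (`sigmaRule_ker`), and more generally `eval⁻¹(Λ)` is Σ-closed for every DISCRETE subgroup
  `Λ ≤ ℝ` (`sigmaRule_comap_of_discrete`); corollary `value_resum_eq_zero_of_termwise`: no
  telescoping of a periodicity family to a non-zero anchor is a dominated instance (census §2.3).
* §5 NEGATION by-products: the `∀R`-language of the crux does not tolerate non-monotone pieces —
  the naive `∀R`-forms of `π`-cancellation and of Carlson-closure are REFUTED by the Σ-closed
  subgroups `eval⁻¹(ℤπ)`, `eval⁻¹(ℤ)` (`not_forall_sigmaRule_piCancellation`,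
  `not_forall_sigmaRule_carlson`); absorption of Σ-derivable levers (`seriesKernel_iff_residual`).

References: Kontsevich–Zagier 2001 §1.2 (Conjecture 1), §4.1; Huber–Müller-Stach 2017 Conj.
13.2.1; Ayoub 2014 Def. 6 / Conj. 7; Huber–Wüstholz 2022 App. A.4; Petkovšek–Wilf–Zeilberger
1996 (A = B); Guillera 2025 Thm 1.1 (periodic Carlson); Andrews–Askey–Roy 1999 Thm 2.8.1.
-/

set_option linter.dupNamespace false
set_option maxHeartbeats 800000

noncomputable section

namespace Summit.KontsevichZagierPeriods.KontsevichZagierPeriods.Cruxes.SeriesKernel.StrategyCensus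

open scoped BigOperators
open MeasureTheory Set Filter
open scoped Topology
open Literature.NumberTheory.Transcendental
open Summit.KontsevichZagierPeriods.KontsevichZagierPeriods.Theses

/-! ## §1 The language: Σ-closed subgroups and the least one -/

/-- **The Σ-rule for a subgroup `R`** (dominated rational-geometric termwise summation): the
closure hypothesis of `WZCosetWall.SeriesKernel` with `R` free, VERBATIM. [Kontsevich–Zagier 2001,
§1.2; Petkovšek–Wilf–Zeilberger 1996] -/
def SigmaRule (R : AddSubgroup Literature.NumberTheory.Transcendental.KZ.FormalRep) : Prop :=
  ∀ (n n' d d' : ℕ) (q : (Fin n → ℝ) → ℝ) (q' : (Fin n' → ℝ) → ℝ) (f : Fin d → (Fin n → ℝ) → ℝ) (g : Fin d' → (Fin n' → ℝ) → ℝ) (r : ℕ → Literature.NumberTheory.Transcendental.KZ.IntegralRep n) (s : ℕ → Literature.NumberTheory.Transcendental.KZ.IntegralRep n') (rs : Literature.NumberTheory.Transcendental.KZ.IntegralRep n) (ss : Literature.NumberTheory.Transcendental.KZ.IntegralRep n'), (∀ m, (r m).domain = rs.domain) → (∀ m, (s m).domain = ss.domain) → (∀ x ∈ rs.domain, |q x|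 < 1) → (∀ y ∈ ss.domain, |q' y| < 1) → (∀ m, ∀ x ∈ rs.domain, (r m).integrand x = ∑ j : Fin d, f j x * ((m + (j : ℕ)).choose j : ℝ) * q x ^ m) → (∀ m, ∀ y ∈ ss.domain, (s m).integrand y = ∑ j : Fin d', g j y * ((m + (j : ℕ)).choose j : ℝ) * q' y ^ m) → (∀ x ∈ rs.domain, rs.integrand x = ∑ j : Fin d, f j x / (1 - q x) ^ ((j : ℕ) + 1)) → (∀ y ∈ ss.domain, ss.integrand y = ∑ j : Fin d', g j y / (1 - q' y) ^ ((j : ℕ) + 1)) → MeasureTheory.IntegrableOn (fun x => ∑ j : Fin d, |f j x| / (1 - |q x|) ^ ((j : ℕ) + 1)) rs.domain → MeasureTheory.IntegrableOn (fun y => ∑ j : Fin d', |g j y| / (1 - |q' y|) ^ ((j : ℕ) + 1)) ss.domain → (∀ m, Literature.NumberTheory.Transcendental.KZ.of (r m) - Literature.NumberTheory.Transcendental.KZ.of (s m) ∈ R) → Literature.NumberTheory.Transcendental.KZ.of rs - Literature.NumberTheory.Transcendental.KZ.of ss ∈ R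

/-- `SummationClosure` IS `SigmaRule relations` (definitional). [folklore] -/
theorem summationClosure_iff : WZCosetWall.SummationClosure ↔ SigmaRule KZ.relations := Iff.rfl

/-- `SeriesKernel` unfolded over `SigmaRule` (definitional). [folklore] -/
theorem seriesKernel_iff :
    WZCosetWall.SeriesKernel ↔
      ∀ R : AddSubgroup KZ.FormalRep, KZ.relations ≤ R → SigmaRule R →
        ∀ c : KZ.FormalRep, KZ.eval c = 0 → c ∈ R := Iff.rfl

/-- `SigmaRule` is closed under arbitrary intersections (it is a Horn-type closure condition).
[folklore] -/
theorem sigmaRule_sInf (S : Set (AddSubgroup KZ.FormalRep)) (hS : ∀ R ∈ S, SigmaRule R) :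
    SigmaRule (sInf S) := by
  intro n n' d d' q q' f g r s rs ss h1 h2 h3 h4 h5 h6 h7 h8 h9 h10 hmem
  rw [AddSubgroup.mem_sInf]
  intro R hR
  exact hS R hR n n' d d' q q' f g r s rs ss h1 h2 h3 h4 h5 h6 h7 h8 h9 h10
    (fun m => AddSubgroup.mem_sInf.mp (hmem m) R hR)

/-- **The least Σ-closed subgroup containing the four-move relations** — the relation group of
the calculus KZ^Σ. [Kontsevich–Zagier 2001, §1.2] -/
def sigmaClosure : AddSubgroup KZ.FormalRep :=
  sInf {R | KZ.relations ≤ R ∧ SigmaRule R}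

theorem relations_le_sigmaClosure : KZ.relations ≤ sigmaClosure :=
  le_sInf fun _ hR => hR.1

theorem sigmaRule_sigmaClosure : SigmaRule sigmaClosure :=
  sigmaRule_sInf _ fun _ hR => hR.2

theorem sigmaClosure_le {R : AddSubgroup KZ.FormalRep} (hR : KZ.relations ≤ R) (hS : SigmaRule R) :
    sigmaClosure ≤ R :=
  sInf_le ⟨hR, hS⟩

/-- **`SeriesKernel` is Conjecture 1 for KZ^Σ**: `ker eval ≤ sigmaClosure`. [Kontsevich–Zagier
2001, §1.2 Conjecture 1] -/
theorem seriesKernel_iff_ker_le_sigmaClosure :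
    WZCosetWall.SeriesKernel ↔ ∀ c : KZ.FormalRep, KZ.eval c = 0 → c ∈ sigmaClosure := by
  constructor
  · intro h c hc
    exact h sigmaClosure relations_le_sigmaClosure sigmaRule_sigmaClosure c hc
  · intro h R hR hS c hc
    exact sigmaClosure_le hR hS (h c hc)

/-- **Absorption of Σ-derivable levers.** For every `S ≤ sigmaClosure` (any set of identities the
enlarged calculus already proves), "Conjecture 1 for KZ^Σ modulo `S`" is the crux itself: a line
of the shape (lever `S`) + (residual `ker eval ≤ sigmaClosure ⊔ S`) has the crux as residual.
[folklore] -/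
theorem seriesKernel_iff_residual (S : AddSubgroup KZ.FormalRep) (hS : S ≤ sigmaClosure) :
    WZCosetWall.SeriesKernel ↔ ∀ c : KZ.FormalRep, KZ.eval c = 0 → c ∈ sigmaClosure ⊔ S := by
  rw [sup_eq_left.mpr hS]
  exact seriesKernel_iff_ker_le_sigmaClosure

/-! ## §2 The summit side -/

/-- `KZKernelConjecture → SeriesKernel` (`relations ≤ R`; the Σ-hypothesis is not used): the crux
is summit-implied. [Kontsevich–Zagier 2001, §1.2 Conjecture 1] -/
theorem seriesKernel_of_kzKernelConjecture (h : KZKernelConjecture) : WZCosetWall.SeriesKernel :=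
  fun _ hR _ c hc => hR (h c hc)

/-- `KontsevichZagierPeriods → SeriesKernel`. [Kontsevich–Zagier 2001, §1.2 Conjecture 1] -/
theorem seriesKernel_of_summit (h : _root_.KontsevichZagierPeriods) : WZCosetWall.SeriesKernel :=
  seriesKernel_of_kzKernelConjecture (kzKernelConjecture_iff_isRational.mpr h)

/-- The route's `closes`, restated: `SummationClosure → SeriesKernel → KZKernelConjecture`.
[Kontsevich–Zagier 2001, §1.2 Conjecture 1] -/
theorem kzKernelConjecture_of (hS : WZCosetWall.SummationClosure) (hK : WZCosetWall.SeriesKernel) :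
    KZKernelConjecture :=
  fun c hc => hK KZ.relations le_rfl hS c hc

/-! ## §3 DECOMPOSITION D1 — the `[π]`-cut (items 0541 ∧ 0540, by name) -/

/-- **`SeriesKernel_of_subs : AyoubPiLocalKernel → AyoubPiCancellation → SeriesKernel`** — the
strategist's decomposition of the crux along `[π]` (Kontsevich–Zagier 2001 §4.1 `P̂ = P[(2πi)⁻¹]`;
Ayoub 2014 Def. 6 / Conj. 7), with the children typed BY NAME as the existing shared items
stmt-0541 / stmt-0540 of route AyoubSpecialisation. Proof: the landed dictionary
`kernelForm_iff_ayoubPiLocalKernel_and_ayoubPiCancellation` (pinned-product reduction to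
`KZ.PiLocalKernel` / `KZ.PiCancellation` and `N`-fold peeling) gives `KZKernelConjecture`, and
`relations ≤ R`. [Kontsevich–Zagier 2001, §4.1; Ayoub 2014, Conj. 7] -/
theorem SeriesKernel_of_subs :
    AyoubSpecialisation.AyoubPiLocalKernel → AyoubSpecialisation.AyoubPiCancellation →
      WZCosetWall.SeriesKernel := fun h₁ h₂ =>
  seriesKernel_of_kzKernelConjecture
    (show KZKernelConjecture from
      Summit.KontsevichZagierPeriods.KernelForm.LocaliseAtValuePrime.kernelForm_iff_ayoubPiLocalKernel_and_ayoubPiCancellation.mpr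
        ⟨h₁, h₂⟩)

/-- The same glue with the children's bodies written out (the literal statements of items 0541 and
0540, as `--split --into children.json` files them). [folklore] -/
theorem SeriesKernel_of_subs' :
    (∀ (P : ∀ n : ℕ, Literature.NumberTheory.Transcendental.KZ.IntegralRep n → Literature.NumberTheory.Transcendental.KZ.IntegralRep (n + 2)), (∀ (n : ℕ) (r : Literature.NumberTheory.Transcendental.KZ.IntegralRep n), (P n r).domain = {z : Fin (n + 2) → ℝ | z 0 ^ 2 + z 1 ^ 2 ≤ 1 ∧ (fun i : Fin n => z i.succ.succ) ∈ r.domain} ∧ (P n r).integrand = fun z => r.integrand (fun i : Fin n => z i.succ.succ)) → ∀ c : Literature.NumberTheory.Transcendental.KZ.FormalRep, Literature.NumberTheory.Transcendental.KZ.eval c = 0 → ∃ N : ℕ, (⇑(FreeAbelianGroup.lift (fun s : (Σ n, Literature.NumberTheory.Transcendental.KZ.IntegralRep n) => Literature.NumberTheory.Transcendental.KZ.of (P s.1 s.2))))^[N] c ∈ Literature.NumberTheory.Transcendental.KZ.relations) →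
    (∀ (P : ∀ n : ℕ, Literature.NumberTheory.Transcendental.KZ.IntegralRep n → Literature.NumberTheory.Transcendental.KZ.IntegralRep (n + 2)), (∀ (n : ℕ) (r : Literature.NumberTheory.Transcendental.KZ.IntegralRep n), (P n r).domain = {z : Fin (n + 2) → ℝ | z 0 ^ 2 + z 1 ^ 2 ≤ 1 ∧ (fun i : Fin n => z i.succ.succ) ∈ r.domain} ∧ (P n r).integrand = fun z => r.integrand (fun i : Fin n => z i.succ.succ)) → ∀ c : Literature.NumberTheory.Transcendental.KZ.FormalRep, FreeAbelianGroup.lift (fun s : (Σ n, Literature.NumberTheory.Transcendental.KZ.IntegralRep n) => Literature.NumberTheory.Transcendental.KZ.of (P s.1 s.2)) c ∈ Literature.NumberTheory.Transcendental.KZ.relations → c ∈ Literature.NumberTheory.Transcendental.KZ.relations) →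
    WZCosetWall.SeriesKernel :=
  SeriesKernel_of_subs

/-- Converse bookkeeping 1: the summit gives child 0541 (so the child is a CONSEQUENCE of the summit
used toward it). [folklore] -/
theorem ayoubPiLocalKernel_of_kzKernelConjecture (h : KZKernelConjecture) :
    AyoubSpecialisation.AyoubPiLocalKernel :=
  (Summit.KontsevichZagierPeriods.KernelForm.LocaliseAtValuePrime.kernelForm_iff_ayoubPiLocalKernel_and_ayoubPiCancellation.mp
    h).1

/-- Converse bookkeeping 2: the summit gives child 0540. [folklore] -/
theorem ayoubPiCancellation_of_kzKernelConjecture (h : KZKernelConjecture) :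
    AyoubSpecialisation.AyoubPiCancellation :=
  (Summit.KontsevichZagierPeriods.KernelForm.LocaliseAtValuePrime.kernelForm_iff_ayoubPiLocalKernel_and_ayoubPiCancellation.mp
    h).2

/-- **Exactness of the cut modulo the route's engine**: under `SummationClosure` (the other
binder of `closes`), `SeriesKernel ↔ AyoubPiLocalKernel ∧ AyoubPiCancellation`. So within the
route nothing is lost by the split, and neither child is the crux weakened for free.
[Kontsevich–Zagier 2001, §1.2, §4.1] -/
theorem seriesKernel_iff_subs_of_summationClosure (hS : WZCosetWall.SummationClosure) :
    WZCosetWall.SeriesKernel ↔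
      AyoubSpecialisation.AyoubPiLocalKernel ∧ AyoubSpecialisation.AyoubPiCancellation := by
  constructor
  · intro hK
    exact Summit.KontsevichZagierPeriods.KernelForm.LocaliseAtValuePrime.kernelForm_iff_ayoubPiLocalKernel_and_ayoubPiCancellation.mp
      (kzKernelConjecture_of hS hK)
  · rintro ⟨h₁, h₂⟩
    exact SeriesKernel_of_subs h₁ h₂

/-! ## §4 SOUNDNESS of the Σ-rule: dominated rational-geometric families are summable at value level -/

section Soundness

variable {n d : ℕ}

/-- **Value-level summation of a dominated rational-geometric family.** If `r m = [σ, Σ_j f_j ·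
C(m+j,j) · q^m]` (`|q| < 1` on `σ`), `rs = [σ, Σ_j f_j / (1 − q)^{j+1}]` and the dominating sum
`Σ_j |f_j| / (1 − |q|)^{j+1}` is integrable on `σ`, then `Σ_m value (r m) = value rs`
(Lebesgue dominated convergence for series, Mathlib `hasSum_integral_of_dominated_convergence`,
with the binomial series `Σ_m C(m+j,j) q^m = (1 − q)^{−j−1}`,
`hasSum_choose_mul_geometric_of_norm_lt_one`). [folklore] -/
theorem hasSum_value (q : (Fin n → ℝ) → ℝ) (f : Fin d → (Fin n → ℝ) → ℝ)
    (r : ℕ → KZ.IntegralRep n) (rs : KZ.IntegralRep n)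
    (hdom : ∀ m, (r m).domain = rs.domain) (hq : ∀ x ∈ rs.domain, |q x| < 1)
    (hr : ∀ m, ∀ x ∈ rs.domain, (r m).integrand x = ∑ j : Fin d, f j x * ((m + (j : ℕ)).choose j : ℝ) * q x ^ m)
    (hrs : ∀ x ∈ rs.domain, rs.integrand x = ∑ j : Fin d, f j x / (1 - q x) ^ ((j : ℕ) + 1))
    (hint : IntegrableOn (fun x => ∑ j : Fin d, |f j x| / (1 - |q x|) ^ ((j : ℕ) + 1)) rs.domain) :
    HasSum (fun m => (r m).value) rs.value := by
  have hmeas : MeasurableSet rs.domain := KZ.IntegralRep.measurableSet_domain_holds rs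
  have hnq : ∀ x ∈ rs.domain, ‖q x‖ < 1 := fun x hx => by
    rw [Real.norm_eq_abs]; exact hq x hx
  have hna : ∀ x ∈ rs.domain, ‖|q x|‖ < 1 := fun x hx => by
    rw [Real.norm_eq_abs, abs_abs]; exact hq x hx
  have hval : (fun m => (r m).value) = fun m => ∫ x in rs.domain, (r m).integrand x := by
    funext m
    rw [KZ.IntegralRep.value, hdom m]
  rw [hval, KZ.IntegralRep.value]
  refine hasSum_integral_of_dominated_convergence
    (fun m x => ∑ j : Fin d, |f j x| * ((m + (j : ℕ)).choose j : ℝ) * |q x| ^ m) ?_ ?_ ?_ ?_ ?_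
  · intro m
    have hi : IntegrableOn (r m).integrand rs.domain := by
      rw [← hdom m]; exact (r m).integrableOn
    exact hi.aestronglyMeasurable
  · intro m
    refine ae_restrict_of_forall_mem hmeas fun x hx => ?_
    rw [hr m x hx, Real.norm_eq_abs]
    refine (Finset.abs_sum_le_sum_abs _ _).trans (le_of_eq ?_)
    refine Finset.sum_congr rfl fun j _ => ?_
    rw [abs_mul, abs_mul, abs_pow, Nat.abs_cast]
  · refine ae_restrict_of_forall_mem hmeas fun x hx => ?_
    refine summable_sum fun j _ => ?_
    have := (hasSum_choose_mul_geometric_of_norm_lt_one (j : ℕ) (hna x hx)).mul_left (|f j x|)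
    refine this.summable.congr fun m => ?_
    ring
  · have hint' : Integrable (fun x => ∑ j : Fin d, |f j x| / (1 - |q x|) ^ ((j : ℕ) + 1))
        (volume.restrict rs.domain) := hint
    refine hint'.congr ?_
    refine ae_restrict_of_forall_mem hmeas fun x hx => ?_
    symm
    refine HasSum.tsum_eq ?_
    refine hasSum_sum fun j _ => ?_
    have := (hasSum_choose_mul_geometric_of_norm_lt_one (j : ℕ) (hna x hx)).mul_left (|f j x|)
    simp only [← mul_assoc] at this
    rw [← div_eq_mul_one_div] at this
    exact this
  · refine ae_restrict_of_forall_mem hmeas fun x hx => ?_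
    have hF : (fun m => (r m).integrand x) =
        fun m => ∑ j : Fin d, f j x * ((m + (j : ℕ)).choose j : ℝ) * q x ^ m := by
      funext m; exact hr m x hx
    rw [hF, hrs x hx]
    refine hasSum_sum fun j _ => ?_
    have := (hasSum_choose_mul_geometric_of_norm_lt_one (j : ℕ) (hnq x hx)).mul_left (f j x)
    simp only [← mul_assoc] at this
    rw [← div_eq_mul_one_div] at this
    exact this

/-- **No telescoping across a coset wall (census §2.3).** If a dominated rational-geometric family
has ALL termwise values `0` — e.g. the folded differences `[σ, F(w(m)q^m − w(m+1)q^{m+1})]` of a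
1-periodicity chain — then its resummation has value `0`. Contrapositive: a 1-periodic geometric
family with a NON-ZERO anchor (Gauss triplication, `TriplicationThirdShift`; Bauer's normalised
`S(k)`) telescoped to `k → ∞` is never a dominated instance of the Σ-rule: the rule cannot replace
Carlson's theorem by telescoping. [Andrews–Askey–Roy 1999, Thm 2.8.1; Guillera 2025, Thm 1.1] -/
theorem value_resum_eq_zero_of_termwise (q : (Fin n → ℝ) → ℝ) (f : Fin d → (Fin n → ℝ) → ℝ)
    (r : ℕ → KZ.IntegralRep n) (rs : KZ.IntegralRep n)
    (hdom : ∀ m, (r m).domain = rs.domain) (hq : ∀ x ∈ rs.domain, |q x| < 1)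
    (hr : ∀ m, ∀ x ∈ rs.domain, (r m).integrand x = ∑ j : Fin d, f j x * ((m + (j : ℕ)).choose j : ℝ) * q x ^ m)
    (hrs : ∀ x ∈ rs.domain, rs.integrand x = ∑ j : Fin d, f j x / (1 - q x) ^ ((j : ℕ) + 1))
    (hint : IntegrableOn (fun x => ∑ j : Fin d, |f j x| / (1 - |q x|) ^ ((j : ℕ) + 1)) rs.domain)
    (h0 : ∀ m, (r m).value = 0) : rs.value = 0 := by
  have h := hasSum_value q f r rs hdom hq hr hrs hint
  have h' : HasSum (fun m => (r m).value) 0 := by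
    simp only [h0]
    exact hasSum_zero
  exact h.unique h'

/-- **`eval⁻¹(Λ)` is Σ-closed for every discrete subgroup `Λ ≤ ℝ`.** Termwise differences
`a_m ∈ Λ` with `Σ_m a_m` convergent (by `hasSum_value` on both sides) tend to `0`, hence vanish
eventually, so the sum is a finite sum of elements of `Λ`. [folklore] -/
theorem sigmaRule_comap_of_discrete (Λ : AddSubgroup ℝ)
    (hΛ : ∃ ε : ℝ, 0 < ε ∧ ∀ x ∈ Λ, |x| < ε → x = 0) :
    SigmaRule (Λ.comap KZ.eval) := by
  obtain ⟨ε, hε, hdisc⟩ := hΛ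
  intro n n' d d' q q' f g r s rs ss hdom hdom' hq hq' hr hs hrs hss hint hint' hmem
  have h1 := hasSum_value q f r rs hdom hq hr hrs hint
  have h2 := hasSum_value q' g s ss hdom' hq' hs hss hint'
  have hmemΛ : ∀ m, (r m).value - (s m).value ∈ Λ := fun m => by
    have := hmem m
    rwa [AddSubgroup.mem_comap, map_sub, KZ.eval_of, KZ.eval_of] at this
  have h3 : HasSum (fun m => (r m).value - (s m).value) (rs.value - ss.value) := h1.sub h2
  have h4 : Tendsto (fun m => (r m).value - (s m).value) atTop (𝓝 0) :=
    h3.summable.tendsto_atTop_zero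
  obtain ⟨M, hM⟩ : ∃ M : ℕ, ∀ m ≥ M, (r m).value - (s m).value = 0 := by
    obtain ⟨N, hN⟩ := (Metric.tendsto_atTop.mp h4) ε hε
    exact ⟨N, fun m hm => hdisc _ (hmemΛ m) (by simpa [Real.dist_eq] using hN m hm)⟩
  have h5 : HasSum (fun m => (r m).value - (s m).value)
      (∑ m ∈ Finset.range M, ((r m).value - (s m).value)) :=
    hasSum_sum_of_ne_finset_zero fun m hm => hM m (by simpa using hm)
  rw [AddSubgroup.mem_comap, map_sub, KZ.eval_of, KZ.eval_of, h3.unique h5]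
  exact sum_mem fun m _ => hmemΛ m

/-- `relations ≤ eval⁻¹(Λ)` for every `Λ` (soundness of the four moves). [Kontsevich–Zagier 2001,
§1.2] -/
theorem relations_le_comap (Λ : AddSubgroup ℝ) : KZ.relations ≤ Λ.comap KZ.eval :=
  fun c hc => by
    rw [AddSubgroup.mem_comap, (AddMonoidHom.mem_ker).mp (KZ.relations_le_ker_eval_holds hc)]
    exact Λ.zero_mem

/-- **`ker eval` is Σ-closed** (soundness of the summation rule; the route header's "Sound: ker
eval is closed under the rule (dominated convergence)", now a theorem). [folklore] -/
theorem sigmaRule_ker : SigmaRule KZ.eval.ker := by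
  have h := sigmaRule_comap_of_discrete ⊥ ⟨1, one_pos, fun x hx _ => (AddSubgroup.mem_bot.mp hx)⟩
  rwa [← AddMonoidHom.comap_bot]

/-- **The summit implies the route's engine**: `KZKernelConjecture → SummationClosure`
(`relations = ker eval`, which is Σ-closed). [Kontsevich–Zagier 2001, §1.2] -/
theorem summationClosure_of_kzKernelConjecture (h : KZKernelConjecture) :
    WZCosetWall.SummationClosure := by
  have hEq : KZ.relations = KZ.eval.ker :=
    le_antisymm KZ.relations_le_ker_eval_holds fun c hc => h c ((AddMonoidHom.mem_ker).mp hc)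
  rw [summationClosure_iff, hEq]
  exact sigmaRule_ker

/-- **The route's thesis is EXACTLY the summit**: `KZKernelConjecture ↔ SummationClosure ∧
SeriesKernel`. [Kontsevich–Zagier 2001, §1.2 Conjecture 1] -/
theorem kzKernelConjecture_iff_summationClosure_and_seriesKernel :
    KZKernelConjecture ↔ WZCosetWall.SummationClosure ∧ WZCosetWall.SeriesKernel :=
  ⟨fun h => ⟨summationClosure_of_kzKernelConjecture h, seriesKernel_of_kzKernelConjecture h⟩,
    fun h => kzKernelConjecture_of h.1 h.2⟩

/-- `sigmaClosure ≤ ker eval` (KZ^Σ is sound), hence `SeriesKernel ↔ sigmaClosure = ker eval`.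
[folklore] -/
theorem sigmaClosure_le_ker : sigmaClosure ≤ KZ.eval.ker :=
  sigmaClosure_le KZ.relations_le_ker_eval_holds sigmaRule_ker

theorem seriesKernel_iff_sigmaClosure_eq_ker :
    WZCosetWall.SeriesKernel ↔ sigmaClosure = KZ.eval.ker := by
  rw [seriesKernel_iff_ker_le_sigmaClosure]
  constructor
  · intro h
    exact le_antisymm sigmaClosure_le_ker fun c hc => h c ((AddMonoidHom.mem_ker).mp hc)
  · intro h c hc
    rw [h]
    exact (AddMonoidHom.mem_ker).mpr hc

end Soundness

/-! ## §5 NEGATION by-products: the `∀R`-language refuses non-monotone pieces -/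

/-- `ℤ·θ` is discrete for `θ ≠ 0`. [folklore] -/
theorem zmultiples_discrete {θ : ℝ} (hθ : θ ≠ 0) :
    ∃ ε : ℝ, 0 < ε ∧ ∀ x ∈ AddSubgroup.zmultiples θ, |x| < ε → x = 0 := by
  refine ⟨|θ|, abs_pos.mpr hθ, fun x hx hlt => ?_⟩
  obtain ⟨k, rfl⟩ := AddSubgroup.mem_zmultiples_iff.mp hx
  rw [zsmul_eq_mul, abs_mul] at hlt
  have h1 : |(k : ℝ)| < 1 := by
    by_contra hcon
    push Not at hcon
    have := mul_le_mul_of_nonneg_right hcon (abs_nonneg θ)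
    linarith
  have h2 : ((|k| : ℤ) : ℝ) < 1 := by rw [Int.cast_abs]; exact h1
  have hk0 : k = 0 := Int.abs_lt_one_iff.mp (by exact_mod_cast h2)
  simp [hk0]

/-- **The naive `∀R`-form of `π`-cancellation is FALSE.** "Every Σ-closed `R ⊇ relations`
reflects multiplication by `[π]`" fails at `R = eval⁻¹(ℤπ)`: `[π]·[pt, 1]` has value `π ∈ ℤπ` but
`[pt, 1] ∉ eval⁻¹(ℤπ)` (`π` irrational, Mathlib `irrational_pi`). Hence any `π`-split of
`SeriesKernel` must phrase cancellation over the LEAST Σ-closure (`sigmaClosure`), never over all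
Σ-closed `R`. [Kontsevich–Zagier 2001, §4.1; Lambert 1761 / Niven 1947] -/
theorem not_forall_sigmaRule_piCancellation :
    ¬ ∀ R : AddSubgroup KZ.FormalRep, KZ.relations ≤ R → SigmaRule R →
        ∀ c : KZ.FormalRep, KZ.of KZ.piRep * c ∈ R → c ∈ R := by
  intro h
  set Λ : AddSubgroup ℝ := AddSubgroup.zmultiples Real.pi
  have hmem : KZ.of KZ.piRep * KZ.of (Literature.Barriers.KontsevichZagierPeriods.KZ.constRep 1) ∈
      Λ.comap KZ.eval := by
    rw [AddSubgroup.mem_comap, KZ.eval_piRep_mul, KZ.eval_of,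
      Literature.Barriers.KontsevichZagierPeriods.KZ.constRep_value, Rat.cast_one, mul_one]
    exact AddSubgroup.mem_zmultiples Real.pi
  have hc := h (Λ.comap KZ.eval) (relations_le_comap Λ)
    (sigmaRule_comap_of_discrete Λ (zmultiples_discrete Real.pi_ne_zero)) _ hmem
  rw [AddSubgroup.mem_comap, KZ.eval_of, Literature.Barriers.KontsevichZagierPeriods.KZ.constRep_value] at hc
  simp only [Rat.cast_one] at hc
  obtain ⟨k, hk⟩ := AddSubgroup.mem_zmultiples_iff.mp hc
  rw [zsmul_eq_mul] at hk
  have hk0 : (k : ℝ) ≠ 0 := by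
    intro h0
    rw [h0, zero_mul] at hk
    exact zero_ne_one hk
  have hpi : Real.pi = (((k : ℚ)⁻¹ : ℚ) : ℝ) := by
    push_cast
    field_simp
    linarith [hk, mul_comm (k : ℝ) Real.pi]
  exact irrational_pi.ne_rat _ hpi

/-- **The Carlson rule for a subgroup `R`**: the closure hypothesis of `CarlsonRule.CarlsonKernel`
with `R` free, VERBATIM. [Boas 1954, Thm 9.2.1; Andrews–Askey–Roy 1999, Thm 2.8.1] -/
def CarlsonRuleFor (R : AddSubgroup Literature.NumberTheory.Transcendental.KZ.FormalRep) : Prop :=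
  ∀ (n n' : ℕ) (σ : Set (Fin n → ℝ)) (τ : Set (Fin n' → ℝ)) (f g : (Fin n → ℝ) → ℝ) (f' g' : (Fin n' → ℝ) → ℝ) (M : ℝ) (r : ℕ → Literature.NumberTheory.Transcendental.KZ.IntegralRep n) (s : ℕ → Literature.NumberTheory.Transcendental.KZ.IntegralRep n'), (∀ x ∈ σ, 0 ≤ g x ∧ g x ≤ M) → (∀ y ∈ τ, 0 ≤ g' y ∧ g' y ≤ M) → (∀ m, (r m).domain = σ ∧ Set.EqOn (r m).integrand (fun x => f x * g x ^ m) σ) → (∀ m, (s m).domain = τ ∧ Set.EqOn (s m).integrand (fun y => f' y * g' y ^ m) τ) → (∀ m, Literature.NumberTheory.Transcendental.KZ.of (r m) - Literature.NumberTheory.Transcendental.KZ.of (s m) ∈ R) → ∀ (k : ℚ), 0 ≤ k → ∀ (rk : Literature.NumberTheory.Transcendental.KZ.IntegralRep n) (sk : Literature.NumberTheory.Transcendental.KZ.IntegralRep n'), rk.domain = σ → Set.EqOn rk.integrand (fun x => f x * g x ^ (k : ℝ)) σ → sk.domain = τ → Set.EqOn sk.integrand (fun y => f' y * g' y ^ (k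 : ℝ)) τ → Literature.NumberTheory.Transcendental.KZ.of rk - Literature.NumberTheory.Transcendental.KZ.of sk ∈ R

/-- A real algebraic constant as a `0`-dimensional representation `[pt, a]`. [Kontsevich–Zagier
2001, §1.1] -/
def algConstRep (a : ℝ) (ha : IsAlgebraic ℚ a) : KZ.IntegralRep 0 where
  domain := Set.univ
  integrand := fun _ => a
  isSemialgebraic_domain := Literature.ModelTheory.ExponentialFields.isSemialgebraic_univ
  isSemialgebraicFunOn_integrand :=
    isSemialgebraicFunOn_const_of_isAlgebraic Literature.ModelTheory.ExponentialFields.isSemialgebraic_univ ha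
  integrableOn := by
    have : volume (Set.univ : Set (Fin 0 → ℝ)) = 1 := by rw [volume_pi, Measure.pi_univ]; simp
    exact integrableOn_const (by simp [this])

@[simp] theorem algConstRep_value (a : ℝ) (ha : IsAlgebraic ℚ a) : (algConstRep a ha).value = a := by
  have hv : volume (Set.univ : Set (Fin 0 → ℝ)) = 1 := by rw [volume_pi, Measure.pi_univ]; simp
  simp [KZ.IntegralRep.value, algConstRep, Measure.real, hv]

theorem isAlgebraic_sqrt_two : IsAlgebraic ℚ (Real.sqrt 2) := by
  refine ⟨Polynomial.X ^ 2 - Polynomial.C 2, ?_, ?_⟩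
  · intro h0
    have := congrArg (Polynomial.eval 0) h0
    simp at this
  · simp [Real.sq_sqrt]

/-- **The naive `∀R`-form "Σ-closed ⇒ Carlson-closed" is FALSE.** `R = eval⁻¹(ℤ)` is Σ-closed and
contains `relations`, the constant families `r_m = [pt, 2^m]`, `s_m = [pt, 0]` satisfy
`[r_m] − [s_m] ∈ R` for every `m`, but at `k = 1/2` the interpolated pair has
`eval = √2 ∉ ℤ`. So "the summation rule subsumes Carlson's rule" cannot be filed in the `∀R`
language either; over `sigmaClosure` it is an open inclusion KZ^C ⊆ KZ^Σ nobody has a reason to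
expect. [Boas 1954, Thm 9.2.1] -/
theorem not_forall_sigmaRule_carlson :
    ¬ ∀ R : AddSubgroup KZ.FormalRep, KZ.relations ≤ R → SigmaRule R → CarlsonRuleFor R := by
  intro h
  set Λ : AddSubgroup ℝ := AddSubgroup.zmultiples (1 : ℝ)
  have hR := h (Λ.comap KZ.eval) (relations_le_comap Λ)
    (sigmaRule_comap_of_discrete Λ (zmultiples_discrete one_ne_zero))
  -- the constant families on `ℝ⁰ = {pt}`
  have key := hR 0 0 Set.univ Set.univ (fun _ => 1) (fun _ => 2) (fun _ => 0) (fun _ => 0) 2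
    (fun m => Literature.Barriers.KontsevichZagierPeriods.KZ.constRep (2 ^ m))
    (fun _ => Literature.Barriers.KontsevichZagierPeriods.KZ.constRep 0)
    (fun _ _ => by norm_num) (fun _ _ => by norm_num)
    (fun m => ⟨rfl, fun x _ => by simp [Literature.Barriers.KontsevichZagierPeriods.KZ.constRep]⟩)
    (fun m => ⟨rfl, fun x _ => by simp [Literature.Barriers.KontsevichZagierPeriods.KZ.constRep]⟩)
    (fun m => by
      rw [AddSubgroup.mem_comap, map_sub, KZ.eval_of, KZ.eval_of,
        Literature.Barriers.KontsevichZagierPeriods.KZ.constRep_value,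
        Literature.Barriers.KontsevichZagierPeriods.KZ.constRep_value]
      refine AddSubgroup.mem_zmultiples_iff.mpr ⟨2 ^ m, ?_⟩
      push_cast
      simp)
    (1 / 2) (by norm_num) (algConstRep (Real.sqrt 2) isAlgebraic_sqrt_two)
    (Literature.Barriers.KontsevichZagierPeriods.KZ.constRep 0) rfl
    (fun x _ => by
      simp only [algConstRep, one_mul]
      rw [Real.sqrt_eq_rpow]
      norm_num)
    rfl (fun x _ => by simp [Literature.Barriers.KontsevichZagierPeriods.KZ.constRep])
  rw [AddSubgroup.mem_comap, map_sub, KZ.eval_of, KZ.eval_of, algConstRep_value,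
    Literature.Barriers.KontsevichZagierPeriods.KZ.constRep_value] at key
  obtain ⟨k, hk⟩ := AddSubgroup.mem_zmultiples_iff.mp key
  simp only [zsmul_eq_mul, mul_one, Rat.cast_zero, sub_zero] at hk
  exact irrational_sqrt_two.ne_int k hk.symm

end Summit.KontsevichZagierPeriods.KontsevichZagierPeriods.Cruxes.SeriesKernel.StrategyCensus

end
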